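import Mathlib.RingTheory.MvPolynomial.WeightedHomogeneous
import Mathlib.Algebra.Polynomial.Reverse
import Mathlib.RingTheory.Ideal.Quotient.Operations
import Summits.ValiantsHypothesis.ValiantsHypothesis.Theorems.BorderApolarityFixedWitnessObstructionQPDeborderOrder

/-!
# Border apolarity, crux `FixedWitnessObstructionQP` — de-bordering by order: FRAME CHANGE by potentials

Route `ValiantsHypothesis/BorderApolarity`, crux item `stmt-ValiantsHypothesis-5778`, line `toric-face-debordering`,
reshape 4b (lead seat -2).  The order of the holomorphic family whose `ε`-coefficient is a given toric slice is NOT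
intrinsic: rescaling the rows and columns of the layered matrix by powers of `ε` ("potentials" `p_a`, `q_b` with
`p_a + q_b ≥` every weight occurring in entry `(a, b)`, Egerváry 1931 / Murota 1995) keeps the layers LINEAR and moves the
wanted slice from `ε`-order `e` (the weight level) to `ε`-order `Σ_a p_a + Σ_b q_b − e` — the gap between the value of the
dual assignment LP and the actual top degree.  Formally (no analysis, every `ε` is the polynomial variable):

* `reflect_finset_sum`, `reflect_prod` — `Polynomial.reflect` over finite sums and products;
* `det_reflect_potentials` — **`det (reflect (p a + q b) ∘ Λ) = reflect (Σp + Σq) (det Λ)`** when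
  `deg Λ_ab ≤ p_a + q_b`: every permutation term has the same total `Σ_a (p_{σ a} + q_a) = Σp + Σq`;
* `coeff_det_eq_of_dvd_sub` — if two polynomial matrices agree entrywise modulo `ε^{k+1}` their determinants have the
  same coefficient of `ε^k` (generalises `coeff_det_layers_of_le`);
* `weightedHomogeneousComponent_det_eq_coeff_of_potentials` — **the frame change**: for a matrix `L` of linear forms, a
  weight `w`, a level `e` and feasible potentials `(p, q)` (`wHC_w^j (L_ab) = 0` for `j > p_a + q_b`) with
  `e ≤ Σp + Σq`, the slice `wHC_w^e (det L)` is the order-`k₀` coefficient, `k₀ := Σp + Σq − e`, of the holomorphic family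
  with the LINEAR layers `B'_i := (wHC_w^{p_a + q_b − i} (L_ab))_ab`; with `stub_deborderOrder` (p96327) it costs
  `3((m+1)(k₀+1))^10` to de-border, whatever the heights of `w`, `p`, `q`.

So the line's open sufficient condition `OrderBoundQP` follows from a bound `Σp + Σq − e ≤ 2^polylog(m)` for SOME feasible
potentials of SOME extremal toric representation — by Egerváry's duality the least `Σp + Σq` over feasible integer potentials
is the tropical determinant (maximum weight of a perfect matching) of the entry-weight matrix, so the residue is Murota's
gap "tropdet − deg det ≤ 2^polylog(m)" (crux 4's card `mvmp-order-debordering`, `k₀`; frame-free form `deg Det − deg det`,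
Hirai 2019).  Printed ancestors: Egerváry 1931; Murota 1995 (doi:10.1137/s0097539791201897) §4; Hirai 2019 (arXiv:1805.11245) §4.
-/

open MvPolynomial Polynomial
open scoped BigOperators Matrix Polynomial
open Literature.Computability.AlgebraicComplexity

namespace Summit.ValiantsHypothesis.ValiantsHypothesis.Theorems.BorderApolarityFixedWitnessObstructionQP

set_option linter.dupNamespace false

/-- `reflect N` is additive over finite sums. [folklore] -/
theorem reflect_finset_sum {R : Type*} [Semiring R] {ι : Type*} (s : Finset ι) (f : ι → R[X]) (N : ℕ) :
    reflect N (∑ i ∈ s, f i) = ∑ i ∈ s, reflect N (f i) := by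
  classical
  induction s using Finset.induction_on with
  | empty => simp
  | insert a s ha ih => rw [Finset.sum_insert ha, Finset.sum_insert ha, reflect_add, ih]

/-- `reflect` is multiplicative over finite products once the degree bounds add up:
`reflect (Σ N_i) (∏ f_i) = ∏ reflect N_i f_i` if `deg f_i ≤ N_i`. [folklore] -/
theorem reflect_prod {R : Type*} [CommSemiring R] {ι : Type*} (s : Finset ι) (f : ι → R[X]) (N : ι → ℕ)
    (h : ∀ i ∈ s, (f i).natDegree ≤ N i) :
    reflect (∑ i ∈ s, N i) (∏ i ∈ s, f i) = ∏ i ∈ s, reflect (N i) (f i) := by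
  classical
  induction s using Finset.induction_on with
  | empty => simp [reflect_one]
  | insert a s ha ih =>
    have hdeg : (∏ i ∈ s, f i).natDegree ≤ ∑ i ∈ s, N i :=
      (natDegree_prod_le s f).trans (Finset.sum_le_sum fun i hi => h i (Finset.mem_insert_of_mem hi))
    rw [Finset.sum_insert ha, Finset.prod_insert ha, Finset.prod_insert ha,
      reflect_mul _ _ (h a (Finset.mem_insert_self a s)) hdeg,
      ih fun i hi => h i (Finset.mem_insert_of_mem hi)]

/-- **Determinant of the potential-reflected matrix.**  If `deg Λ_ab ≤ p_a + q_b` for all `a, b` (the potentials are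
FEASIBLE), then reflecting each entry at its own bound reflects the determinant at `Σp + Σq`:
`det (reflect (p a + q b) (Λ a b))_ab = reflect (Σ_a p_a + Σ_b q_b) (det Λ)` — for every permutation `σ` the bounds
`p_{σ a} + q_a` sum to the same `Σp + Σq`.  (Informally: `det (diag(ε^p) · Λ(1/ε) · diag(ε^q)) = ε^{Σp+Σq} det Λ (1/ε)`.)
[cite: Murota1995CombinatorialRelaxation, §4] -/
theorem det_reflect_potentials {R : Type*} [CommRing R] {ι : Type*} [Fintype ι] [DecidableEq ι]
    (Λ : Matrix ι ι R[X]) (p q : ι → ℕ) (h : ∀ a b, (Λ a b).natDegree ≤ p a + q b) :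
    (Matrix.of fun a b => reflect (p a + q b) (Λ a b)).det = reflect (∑ a, p a + ∑ b, q b) Λ.det := by
  rw [Matrix.det_apply, Matrix.det_apply, reflect_finset_sum]
  refine Finset.sum_congr rfl fun σ _ => ?_
  have hS : ∑ a, (p (σ a) + q a) = ∑ a, p a + ∑ b, q b := by
    rw [Finset.sum_add_distrib, Equiv.sum_comp σ p]
  have hprod : reflect (∑ a, p a + ∑ b, q b) (∏ a, Λ (σ a) a) = ∏ a, reflect (p (σ a) + q a) (Λ (σ a) a) := by
    rw [← hS]
    exact reflect_prod Finset.univ (fun a => Λ (σ a) a) (fun a => p (σ a) + q a) fun a _ => h (σ a) a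
  simp only [Matrix.of_apply]
  rw [← hprod]
  rcases Int.units_eq_one_or (Equiv.Perm.sign σ) with hs | hs
  · rw [hs, one_smul, one_smul]
  · rw [hs, Units.neg_smul, one_smul, Units.neg_smul, one_smul, reflect_neg]

/-- Hence the order-`k₀` coefficient of the reflected family is the order-`e` coefficient of the original one whenever
`k₀ + e = Σp + Σq`. [cite: Murota1995CombinatorialRelaxation, §4] -/
theorem coeff_det_reflect_potentials {R : Type*} [CommRing R] {ι : Type*} [Fintype ι] [DecidableEq ι]
    (Λ : Matrix ι ι R[X]) (p q : ι → ℕ) (h : ∀ a b, (Λ a b).natDegree ≤ p a + q b) (k₀ e : ℕ)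
    (hk : k₀ + e = ∑ a, p a + ∑ b, q b) :
    (Matrix.of fun a b => reflect (p a + q b) (Λ a b)).det.coeff k₀ = Λ.det.coeff e := by
  rw [det_reflect_potentials Λ p q h, coeff_reflect, revAt_le (by omega)]
  congr 1
  omega

/-- **Congruent entries, congruent determinants.**  If two polynomial matrices agree entrywise modulo `ε^{k+1}` then
their determinants have the same coefficient of `ε^k`. [folklore] -/
theorem coeff_det_eq_of_dvd_sub {n : Type*} [Fintype n] [DecidableEq n] {R : Type*} [CommRing R]
    (P Q : Matrix n n R[X]) (k : ℕ) (h : ∀ a b, (X : R[X]) ^ (k + 1) ∣ P a b - Q a b) :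
    P.det.coeff k = Q.det.coeff k := by
  set I : Ideal R[X] := Ideal.span {(X : R[X]) ^ (k + 1)} with hI
  set π : R[X] →+* R[X] ⧸ I := Ideal.Quotient.mk I with hπ
  have hdet : π P.det = π Q.det := by
    rw [RingHom.map_det, RingHom.map_det]
    congr 1
    ext a b
    simp only [RingHom.mapMatrix_apply, Matrix.map_apply]
    rw [hπ, Ideal.Quotient.eq, hI, Ideal.mem_span_singleton]
    exact h a b
  rw [hπ, Ideal.Quotient.eq, hI, Ideal.mem_span_singleton] at hdet
  obtain ⟨r, hr⟩ := hdet
  have := congrArg (fun f : R[X] => f.coeff k) hr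
  simp only [Polynomial.coeff_sub, Polynomial.coeff_X_pow_mul'] at this
  rw [if_neg (by omega)] at this
  exact sub_eq_zero.mp this

/-- Reflecting a layered entry at a feasible bound re-indexes its layers:
`reflect N (Σ_{j ≤ N} ε^j b_j) = Σ_{i ≤ N} ε^i b_{N − i}`. [folklore] -/
theorem reflect_sum_monomial {R : Type*} [Semiring R] (N : ℕ) (b : ℕ → R) :
    reflect N (∑ j ∈ Finset.range (N + 1), monomial j (b j)) =
      ∑ i ∈ Finset.range (N + 1), monomial i (b (N - i)) := by
  ext n
  simp only [coeff_reflect, Polynomial.finsetSum_coeff, Polynomial.coeff_monomial, Finset.sum_ite_eq',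
    Finset.mem_range]
  by_cases hn : n ≤ N
  · rw [revAt_le hn, if_pos (by omega), if_pos (by omega)]
  · rw [revAt_eq_self_of_lt (by omega), if_neg (by omega), if_neg (by omega)]

/-- Terms of `ε`-degree `> k` do not matter modulo `ε^{k+1}`:
`ε^{k+1} ∣ Σ_{i ≤ k} ε^i c_i − Σ_{i ≤ K} ε^i c_i` for `k ≤ K`. [folklore] -/
theorem X_pow_dvd_sum_range_sub {R : Type*} [CommRing R] (c : ℕ → R) {k K : ℕ} (hkK : k ≤ K) :
    (X : R[X]) ^ (k + 1) ∣
      ∑ i ∈ Finset.range (k + 1), monomial i (c i) - ∑ i ∈ Finset.range (K + 1), monomial i (c i) := by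
  rw [← Finset.sum_range_add_sum_Ico _ (Nat.succ_le_succ hkK), sub_add_cancel_left, dvd_neg]
  refine Finset.dvd_sum fun j hj => ?_
  have hj' : k + 1 ≤ j := (Finset.mem_Ico.mp hj).1
  exact ⟨monomial (j - (k + 1)) (c j), by rw [X_pow_mul, monomial_mul_X_pow, Nat.sub_add_cancel hj']⟩

/-- A layered sum may be extended by zero layers. [folklore] -/
theorem sum_range_monomial_eq_of_zero {R : Type*} [Semiring R] (c : ℕ → R) {M K : ℕ} (hMK : M ≤ K)
    (hz : ∀ j, M < j → c j = 0) :
    ∑ j ∈ Finset.range (M + 1), monomial j (c j) = ∑ j ∈ Finset.range (K + 1), monomial j (c j) := by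
  refine Finset.sum_subset (Finset.range_subset_range.mpr (by omega)) fun j hjK hjM => ?_
  rw [hz j (by simpa [Finset.mem_range, Nat.lt_succ_iff] using hjM), map_zero]

/-- **The frame change (de-bordering by order, reshape 4b).**  Let `L` be a square matrix of linear forms, `w` a weight,
`e` a level, and `(p, q)` FEASIBLE POTENTIALS: `wHC_w^j (L_ab) = 0` whenever `j > p_a + q_b` (every variable occurring in
entry `(a, b)` has weight `≤ p_a + q_b`), with `e ≤ Σp + Σq`.  Then the slice `wHC_w^e (det L)` is the order-`k₀`
coefficient, `k₀ = Σp + Σq − e`, of the holomorphic family with the LINEAR layers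
`(B'_i)_ab := wHC_w^{p_a + q_b − i} (L_ab)` (`:= 0` for `i > p_a + q_b`):
`wHC_w^e (det L) = [ε^{k₀}] det (B'₀ + ε B'₁ + ⋯ + ε^{k₀} B'_{k₀})`.
Proof: `wHC_w^e (det L) = [ε^e] det Λ^{(e)}` (`weightedHomogeneousComponent_det_eq_coeff`) `= [ε^e] det Λ` for the
full layered matrix `Λ_ab = Σ_{j ≤ p_a+q_b} ε^j wHC_w^j (L_ab)` (congruence mod `ε^{e+1}`, feasibility)
`= [ε^{k₀}] det (reflect ∘ Λ)` (`coeff_det_reflect_potentials`) and `reflect (p_a + q_b) Λ_ab = Σ_i ε^i (B'_i)_ab`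
(`reflect_sum_monomial`), truncated above `k₀` (congruence mod `ε^{k₀+1}`).
[cite: Murota1995CombinatorialRelaxation, §4] -/
theorem weightedHomogeneousComponent_det_eq_coeff_of_potentials {σ : Type*} [Fintype σ] [DecidableEq σ]
    {ι : Type*} [Fintype ι] [DecidableEq ι] (L : Matrix ι ι (MvPolynomial σ ℂ))
    (hL : ∀ a b, (L a b).IsHomogeneous 1) (w : σ → ℕ) (e : ℕ) (p q : ι → ℕ)
    (hfeas : ∀ a b j, p a + q b < j → weightedHomogeneousComponent w j (L a b) = 0)
    (he : e ≤ ∑ a, p a + ∑ b, q b) :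
    weightedHomogeneousComponent w e L.det =
      (Matrix.det (Matrix.of fun a b => ∑ i ∈ Finset.range ((∑ a, p a + ∑ b, q b - e) + 1),
        Polynomial.monomial i (if i ≤ p a + q b then
          weightedHomogeneousComponent w (p a + q b - i) (L a b) else 0))).coeff
        (∑ a, p a + ∑ b, q b - e) := by
  set S : ℕ := ∑ a, p a + ∑ b, q b with hS
  -- the full layered matrix (entry `(a,b)` carries its `p a + q b + 1` layers)
  set Λ : Matrix ι ι (Polynomial (MvPolynomial σ ℂ)) := Matrix.of fun a b =>
    ∑ j ∈ Finset.range (p a + q b + 1), monomial j (weightedHomogeneousComponent w j (L a b)) with hΛ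
  -- step 1: the slice is `[ε^e] det Λ^{(e)}` and `Λ^{(e)} ≡ Λ (mod ε^{e+1})` by feasibility
  rw [weightedHomogeneousComponent_det_eq_coeff L hL w e]
  have h1 : (Matrix.det (Matrix.of fun a b => ∑ j ∈ Finset.range (e + 1),
      monomial j (weightedHomogeneousComponent w j (L a b)))).coeff e = Λ.det.coeff e := by
    refine coeff_det_eq_of_dvd_sub _ _ e fun a b => ?_
    simp only [Matrix.of_apply, hΛ]
    rw [sum_range_monomial_eq_of_zero (fun j => weightedHomogeneousComponent w j (L a b))
      (le_max_right e (p a + q b)) fun j hj => hfeas a b j hj]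
    exact X_pow_dvd_sum_range_sub _ (le_max_left e (p a + q b))
  rw [h1]
  -- step 2: frame change on the full layered matrix
  have hdegΛ : ∀ a b, (Λ a b).natDegree ≤ p a + q b := fun a b => by
    simp only [hΛ, Matrix.of_apply]
    exact natDegree_sum_le_of_forall_le _ _ fun j hj =>
      (natDegree_monomial_le _).trans (Nat.lt_succ_iff.mp (Finset.mem_range.mp hj))
  rw [← coeff_det_reflect_potentials Λ p q hdegΛ (S - e) e (by omega)]
  -- step 3: the reflected entries are the re-indexed layers; truncate above `k₀ = S - e`
  refine coeff_det_eq_of_dvd_sub _ _ (S - e) fun a b => ?_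
  simp only [Matrix.of_apply, hΛ]
  rw [reflect_sum_monomial (p a + q b) (fun j => weightedHomogeneousComponent w j (L a b))]
  have hre : (∑ i ∈ Finset.range (p a + q b + 1),
      monomial i (weightedHomogeneousComponent w (p a + q b - i) (L a b))) =
      ∑ i ∈ Finset.range (p a + q b + 1), monomial i
        (if i ≤ p a + q b then weightedHomogeneousComponent w (p a + q b - i) (L a b) else 0) :=
    Finset.sum_congr rfl fun i hi => by
      rw [if_pos (Nat.lt_succ_iff.mp (Finset.mem_range.mp hi))]
  rw [hre, sum_range_monomial_eq_of_zero
    (fun i => if i ≤ p a + q b then weightedHomogeneousComponent w (p a + q b - i) (L a b) else 0)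
    (le_max_left (p a + q b) (S - e)) fun j hj => if_neg (by omega), ← dvd_neg, neg_sub]
  exact X_pow_dvd_sum_range_sub _ (le_max_right (p a + q b) (S - e))

/-- **Frame change, packaged** (registered stub `stub_deborderFrame` of crux stmt-5778, line `toric-face-debordering`,
reshape 4b): for every matrix of linear forms, weight, level and FEASIBLE potentials with `e ≤ Σp + Σq`, the weight-`e`
slice of the determinant is the order-`(Σp + Σq − e)` coefficient of the holomorphic family of LINEAR layers
`(wHC_w^{p_a + q_b − i} (L_ab))_ab`. [cite: Murota1995CombinatorialRelaxation, §4] -/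
theorem stub_deborderFrame : ∀ (σ : Type) [Fintype σ] [DecidableEq σ] (ι : Type) [Fintype ι] [DecidableEq ι] (L : Matrix ι ι (MvPolynomial σ ℂ)), (∀ a b, (L a b).IsHomogeneous 1) → ∀ (w : σ → ℕ) (e : ℕ) (p q : ι → ℕ), (∀ a b j, p a + q b < j → MvPolynomial.weightedHomogeneousComponent w j (L a b) = 0) → e ≤ ∑ a, p a + ∑ b, q b → MvPolynomial.weightedHomogeneousComponent w e L.det = (Matrix.det (Matrix.of fun a b => ∑ i ∈ Finset.range ((∑ a, p a + ∑ b, q b - e) + 1), Polynomial.monomial i (if i ≤ p a + q b then MvPolynomial.weightedHomogeneousComponent w (p a + q b - i) (L a b) else 0))).coeff (∑ a, p a + ∑ b, q b - e) :=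
  fun _ _ _ _ _ _ L hL w e p q hfeas he =>
    weightedHomogeneousComponent_det_eq_coeff_of_potentials L hL w e p q hfeas he

end Summit.ValiantsHypothesis.ValiantsHypothesis.Theorems.BorderApolarityFixedWitnessObstructionQP
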